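import Literature.RepresentationTheory.HeisenbergGroup.SchrodingerSymplecticGenerators
import HarnessLib

/-!
# The polarisation mover: a symplectic element carrying an adapted Darboux family to the standard one
# (piece P4, generic half, of the support-form proof of `rankOne_theta_lines_disjoint`)

Topic `RepresentationTheory/HeisenbergGroup`; namespace `Literature.RepresentationTheory.HeisenbergGroup`.  THEOREMS ONLY
(no definition, no named fact, no `sorry`).  Pure linear algebra over a field `K`.

Currency of the tree: `V = X × Y`, `X = Y = K^ι`, the duality `β_T(x, y) = x ⬝ (T y)` of a matrix `T` (`Matrix.toLinearMap₂'`,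
as in `localPairing` / `LocalSp` of `GelbartRogawski1991/LocalUnitarySplittingDatum`), the commutator form
`A = alt (polar β_T)`, `A((x,y),(x',y')) = x ⬝ T y' - x' ⬝ T y`, and `Sp = symplecticGroup (polar β_T)`
(`SchrodingerSiegelParabolic`).  The STANDARD Darboux family of `A` is `fᵢ = (eᵢ, 0)`, `f'ⱼ = (0, T⁻¹ eⱼ)`.

* §1 `exists_symplecticGroup_symm_apply_eq_sum` — **the mover**.  For any ADAPTED DARBOUX FAMILY `x', y' : ι → V`
  (`A(x'ᵢ, x'ⱼ) = 0`, `A(y'ᵢ, y'ⱼ) = 0`, `A(x'ᵢ, y'ⱼ) = δᵢⱼ`) and `det T` a unit there is `g ∈ Sp` with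
  `g⁻¹(x, y) = Σᵢ xᵢ x'ᵢ + Σⱼ (T y)ⱼ y'ⱼ`, i.e. `g x'ᵢ = fᵢ`, `g y'ⱼ = f'ⱼ` (Witt: `Sp` is transitive on Darboux families;
  here the map is written down and shown injective from `A(g⁻¹p, g⁻¹q) = A(p, q)` and the non-degeneracy of `A`).
* §2 `apply_comp_symm_eq_of_lower`, `coe_conj_eq_unipotentσ_of_lower`, `conj_eq_unipotentSp_of_lower` — **a nilpotent
  `𝔫` with `𝔫 x'ᵢ = Σⱼ Nⱼᵢ y'ⱼ`, `𝔫 y'ⱼ = 0` is moved to the Siegel-lower position**: `g 𝔫 g⁻¹ (x, y) = (0, T⁻¹N x)`, and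
  for `u ∈ Sp` with `u = 1 + b 𝔫`: `g u g⁻¹ = n(b · T⁻¹N)` (`unipotentσ` / `unipotentSp`), whose second-degree character is
  `½ β_T(x, b T⁻¹N x) = ½ b (x ⬝ N x)` (`toLinearMap₂'_toLin'_inv_mul`).
* §3 `apply_comp_symm_eq_of_upper`, `coe_conj_apply_of_upper` — **a nilpotent `𝔫'` with `𝔫' y'ⱼ = Σᵢ N'ᵢⱼ x'ᵢ`,
  `𝔫' x'ᵢ = 0` is moved to the Siegel-upper position**: `g (1 + b𝔫') g⁻¹ (x, y) = (x + b (N'T) y, y)`.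

Use (cell hodgecm-mathlib, row IV-4(c1), KEY `b4-rank-one-theta-lines-disjoint`, piece P4): `V` the doubled space
`𝕎_v ⊕ 𝕎_v⁻` of a rank-`3` hermitian space at a non-split place, `x', y'` the Darboux family adapted to an isotropic
vector `r`, its hyperbolic partner `r'` and the anisotropic line between them, `𝔫`/`𝔫'` the derivatives of the
diagonally doubled root subgroups of `r`/`r'`; after the move the root subgroup of `r` acts in the Schrödinger model by the
second-degree character of an anisotropic quaternary form and that of `r'` by its partial-Fourier conjugate
[MoeglinVignerasWaldspurger1987, Chap. 2 II.6].  Nothing about unitary groups is in this file.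

## References
* [MoeglinVignerasWaldspurger1987] C. Mœglin, M.-F. Vignéras, J.-L. Waldspurger, *Correspondances de Howe sur un corps
  p-adique*, LNM 1291 (1987), Chap. 1 I.10–I.11 (Witt), Chap. 2 II.6 (the Siegel parabolic in the Schrödinger model).
* [Weil1964] A. Weil, *Sur certains groupes d'opérateurs unitaires*, Acta Math. 111 (1964), n° 6, p. 151.
-/

set_option autoImplicit false

noncomputable section

namespace Literature.RepresentationTheory.HeisenbergGroup

open Matrix

variable {K : Type*} [Field K] {ι : Type*} [Fintype ι] [DecidableEq ι] (T : Matrix ι ι K)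

/-- the commutator form of `β_T` in coordinates: `A((x,y),(x',y')) = x ⬝ T y' - x' ⬝ T y`. [cite: Weil1964, n° 5, p. 150] -/
theorem alt_polar_toLinearMap₂'_apply (p q : (ι → K) × (ι → K)) :
    alt (polar (Matrix.toLinearMap₂' K T)) p q = p.1 ⬝ᵥ (T *ᵥ q.2) - q.1 ⬝ᵥ (T *ᵥ p.2) := by
  rw [alt_apply, polar_apply, polar_apply, Matrix.toLinearMap₂'_apply', Matrix.toLinearMap₂'_apply']

/-- `A` is antisymmetric: `A q p = - A p q`. [cite: Weil1964, n° 5, p. 150] -/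
theorem alt_polar_toLinearMap₂'_swap (p q : (ι → K) × (ι → K)) :
    alt (polar (Matrix.toLinearMap₂' K T)) q p = -alt (polar (Matrix.toLinearMap₂' K T)) p q := by
  rw [alt_apply, alt_apply, neg_sub]

/-- **non-degeneracy of `A` for `det T` a unit**: `A(p, q) = 0` for all `q` forces `p = 0`. [cite: Weil1964, n° 5, p. 150] -/
theorem eq_zero_of_forall_alt_polar_toLinearMap₂'_eq_zero (hTd : IsUnit T.det) {p : (ι → K) × (ι → K)}
    (h : ∀ q, alt (polar (Matrix.toLinearMap₂' K T)) p q = 0) : p = 0 := by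
  have hT : IsUnit T := (Matrix.isUnit_iff_isUnit_det _).2 hTd
  have h1 : p.1 = 0 := by
    have hs : Function.Surjective fun y : ι → K => T *ᵥ y := Matrix.mulVec_surjective_iff_isUnit.2 hT
    funext i
    obtain ⟨y, hy⟩ := hs (Pi.single i 1)
    have := h (0, y)
    rw [alt_polar_toLinearMap₂'_apply] at this
    simpa [hy] using this
  have h2 : T *ᵥ p.2 = 0 := by
    funext i
    have := h (Pi.single i 1, 0)
    rw [alt_polar_toLinearMap₂'_apply] at this
    simpa using this
  have h3 : p.2 = 0 := (Matrix.mulVec_injective_iff_isUnit.2 hT) (by rw [h2, Matrix.mulVec_zero])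
  exact Prod.ext h1 h3

section Mover

variable (x' y' : ι → (ι → K) × (ι → K))
  (hxx : ∀ i j, alt (polar (Matrix.toLinearMap₂' K T)) (x' i) (x' j) = 0)
  (hyy : ∀ i j, alt (polar (Matrix.toLinearMap₂' K T)) (y' i) (y' j) = 0)
  (hxy : ∀ i j, alt (polar (Matrix.toLinearMap₂' K T)) (x' i) (y' j) = if i = j then 1 else 0)

/-! ## §1 The mover -/

include hxx hxy in
/-- pairing a member of the `x'`-family against a combination `Σ aᵢ x'ᵢ + Σ bⱼ y'ⱼ` reads off `bᵢ`. [cite: Weil1964, n° 6, p. 151] -/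
theorem alt_polar_apply_sum_darboux_left (i : ι) (a b : ι → K) :
    alt (polar (Matrix.toLinearMap₂' K T)) (x' i) (∑ k, a k • x' k + ∑ k, b k • y' k) = b i := by
  simp only [map_add, map_sum, map_smul, smul_eq_mul, hxx, hxy, mul_zero, Finset.sum_const_zero, zero_add, mul_ite,
    mul_one, Finset.sum_ite_eq, Finset.mem_univ, if_true]

include hyy hxy in
/-- pairing a member of the `y'`-family against a combination `Σ aᵢ x'ᵢ + Σ bⱼ y'ⱼ` reads off `-aⱼ`. [cite: Weil1964, n° 6, p. 151] -/
theorem alt_polar_apply_sum_darboux_right (j : ι) (a b : ι → K) :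
    alt (polar (Matrix.toLinearMap₂' K T)) (y' j) (∑ k, a k • x' k + ∑ k, b k • y' k) = -a j := by
  have hyx : ∀ k, alt (polar (Matrix.toLinearMap₂' K T)) (y' j) (x' k) = -(if k = j then 1 else 0) := fun k => by
    rw [alt_polar_toLinearMap₂'_swap, hxy]
  simp only [map_add, map_sum, map_smul, smul_eq_mul, hyy, hyx, mul_zero, Finset.sum_const_zero, add_zero, mul_neg,
    mul_ite, mul_one, Finset.sum_neg_distrib, Finset.sum_ite_eq', Finset.mem_univ, if_true]

include hxx hyy hxy in
/-- **The polarisation mover.**  For an adapted Darboux family `(x', y')` of `A = alt (polar β_T)` (`det T` a unit) there is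
`g ∈ Sp(A)` with `g⁻¹ (x, y) = Σᵢ xᵢ x'ᵢ + Σⱼ (T y)ⱼ y'ⱼ` — equivalently `g x'ᵢ = (eᵢ, 0)` and `g y'ⱼ = (0, T⁻¹eⱼ)`, the
standard Darboux family of `A`.  (Transitivity of `Sp` on symplectic bases.) [cite: MoeglinVignerasWaldspurger1987, Chap. 1 I.10] -/
theorem exists_symplecticGroup_symm_apply_eq_sum (hTd : IsUnit T.det) :
    ∃ g : symplecticGroup (polar (Matrix.toLinearMap₂' K T)), ∀ p : (ι → K) × (ι → K),
      (g : ((ι → K) × (ι → K)) ≃ₗ[K] ((ι → K) × (ι → K))).symm p = ∑ i, p.1 i • x' i + ∑ j, (T *ᵥ p.2) j • y' j := by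
  classical
  -- the candidate inverse
  let h : ((ι → K) × (ι → K)) →ₗ[K] ((ι → K) × (ι → K)) :=
    { toFun := fun p => ∑ i, p.1 i • x' i + ∑ j, (T *ᵥ p.2) j • y' j
      map_add' := fun p q => by
        simp only [Prod.fst_add, Prod.snd_add, Pi.add_apply, Matrix.mulVec_add, add_smul, Finset.sum_add_distrib]
        abel
      map_smul' := fun c p => by
        simp only [Prod.smul_fst, Prod.smul_snd, Pi.smul_apply, Matrix.mulVec_smul, smul_eq_mul, RingHom.id_apply,
          smul_add, Finset.smul_sum, smul_smul] }
  have hh : ∀ p, h p = ∑ i, p.1 i • x' i + ∑ j, (T *ᵥ p.2) j • y' j := fun _ => rfl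
  -- `h` preserves `A`
  have hA : ∀ p q, alt (polar (Matrix.toLinearMap₂' K T)) (h p) (h q) = alt (polar (Matrix.toLinearMap₂' K T)) p q := by
    intro p q
    have hl : ∀ w, alt (polar (Matrix.toLinearMap₂' K T)) (h p) w =
        ∑ i, p.1 i * alt (polar (Matrix.toLinearMap₂' K T)) (x' i) w +
          ∑ j, (T *ᵥ p.2) j * alt (polar (Matrix.toLinearMap₂' K T)) (y' j) w := fun w => by
      simp only [hh, map_add, map_sum, map_smul, LinearMap.add_apply, LinearMap.sum_apply, LinearMap.smul_apply,
        smul_eq_mul]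
    rw [hl]
    simp only [hh, alt_polar_apply_sum_darboux_left T x' y' hxx hxy, alt_polar_apply_sum_darboux_right T x' y' hyy hxy,
      alt_polar_toLinearMap₂'_apply, dotProduct, mul_neg, Finset.sum_neg_distrib, sub_eq_add_neg]
    congr 1
    congr 1
    exact Finset.sum_congr rfl fun j _ => mul_comm _ _
  -- hence injective, hence bijective
  have hinj : Function.Injective h := by
    rw [← LinearMap.ker_eq_bot, LinearMap.ker_eq_bot']
    intro p hp
    exact eq_zero_of_forall_alt_polar_toLinearMap₂'_eq_zero T hTd fun q => by
      rw [← hA, hp, map_zero, LinearMap.zero_apply]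
  have hbij : Function.Bijective h := ⟨hinj, LinearMap.injective_iff_surjective.1 hinj⟩
  let e : ((ι → K) × (ι → K)) ≃ₗ[K] ((ι → K) × (ι → K)) := LinearEquiv.ofBijective h hbij
  have he : ∀ p, e p = h p := fun _ => rfl
  -- `g = e⁻¹` is symplectic
  have hg : e.symm ∈ symplecticGroup (polar (Matrix.toLinearMap₂' K T)) := by
    rw [mem_symplecticGroup]
    intro w w'
    have := hA (e.symm w) (e.symm w')
    rw [← he, ← he, LinearEquiv.apply_symm_apply, LinearEquiv.apply_symm_apply] at this
    rw [← alt_apply, ← alt_apply, this]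
  exact ⟨⟨e.symm, hg⟩, fun p => by rw [LinearEquiv.symm_symm, he, hh]⟩

/-! ## §2 A nilpotent in lower position -/

variable {T x' y'}
variable (g : symplecticGroup (polar (Matrix.toLinearMap₂' K T)))
  (hg : ∀ p : (ι → K) × (ι → K),
    (g : ((ι → K) × (ι → K)) ≃ₗ[K] ((ι → K) × (ι → K))).symm p = ∑ i, p.1 i • x' i + ∑ j, (T *ᵥ p.2) j • y' j)

include hg in
/-- `g⁻¹ (x, 0) = Σ xᵢ x'ᵢ`. [cite: Weil1964, n° 6, p. 151] -/
theorem symm_apply_inl_of_darboux (x : ι → K) :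
    (g : ((ι → K) × (ι → K)) ≃ₗ[K] ((ι → K) × (ι → K))).symm (x, 0) = ∑ i, x i • x' i := by
  rw [hg, Matrix.mulVec_zero]
  simp only [Pi.zero_apply, zero_smul, Finset.sum_const_zero, add_zero]

include hg in
/-- `g⁻¹ (0, y) = Σ (T y)ⱼ y'ⱼ`. [cite: Weil1964, n° 6, p. 151] -/
theorem symm_apply_inr_of_darboux (y : ι → K) :
    (g : ((ι → K) × (ι → K)) ≃ₗ[K] ((ι → K) × (ι → K))).symm (0, y) = ∑ j, (T *ᵥ y) j • y' j := by
  rw [hg]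
  simp only [Pi.zero_apply, zero_smul, Finset.sum_const_zero, zero_add]

include hg in
/-- `g x'ᵢ = (eᵢ, 0)`: the mover carries the `x'`-family to the standard Lagrangian `X × 0`. [cite: Weil1964, n° 6, p. 151] -/
theorem apply_darboux_left (i : ι) :
    (g : ((ι → K) × (ι → K)) ≃ₗ[K] ((ι → K) × (ι → K))) (x' i) = (Pi.single i 1, 0) := by
  rw [← LinearEquiv.eq_symm_apply, symm_apply_inl_of_darboux g hg]
  simp only [Pi.single_apply, ite_smul, one_smul, zero_smul, Finset.sum_ite_eq', Finset.mem_univ, if_true]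

include hg in
/-- `g y'ⱼ = (0, T⁻¹ eⱼ)`: the mover carries the `y'`-family to the `β_T`-dual basis of `0 × Y`. [cite: Weil1964, n° 6, p. 151] -/
theorem apply_darboux_right (hTd : IsUnit T.det) (j : ι) :
    (g : ((ι → K) × (ι → K)) ≃ₗ[K] ((ι → K) × (ι → K))) (y' j) = (0, T⁻¹ *ᵥ Pi.single j 1) := by
  rw [← LinearEquiv.eq_symm_apply, symm_apply_inr_of_darboux g hg, Matrix.mulVec_mulVec, Matrix.mul_nonsing_inv _ hTd,
    Matrix.one_mulVec]
  simp only [Pi.single_apply, ite_smul, one_smul, zero_smul, Finset.sum_ite_eq', Finset.mem_univ, if_true]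

include hg in
/-- **a lower nilpotent is moved to `(x, y) ↦ (0, T⁻¹N x)`**: if `𝔫 x'ᵢ = Σⱼ Nⱼᵢ y'ⱼ` and `𝔫 y'ⱼ = 0` then
`g 𝔫 g⁻¹ (x, y) = (0, (T⁻¹ N) x)`. [cite: MoeglinVignerasWaldspurger1987, Chap. 2 II.6] -/
theorem apply_comp_symm_eq_of_lower (hTd : IsUnit T.det) (𝔫 : ((ι → K) × (ι → K)) →ₗ[K] ((ι → K) × (ι → K)))
    (N : Matrix ι ι K) (hNx : ∀ i, 𝔫 (x' i) = ∑ j, N j i • y' j) (hNy : ∀ j, 𝔫 (y' j) = 0)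
    (p : (ι → K) × (ι → K)) :
    (g : ((ι → K) × (ι → K)) ≃ₗ[K] ((ι → K) × (ι → K)))
        (𝔫 ((g : ((ι → K) × (ι → K)) ≃ₗ[K] ((ι → K) × (ι → K))).symm p)) = (0, (T⁻¹ * N) *ᵥ p.1) := by
  have h1 : 𝔫 ((g : ((ι → K) × (ι → K)) ≃ₗ[K] ((ι → K) × (ι → K))).symm p) = ∑ j, (N *ᵥ p.1) j • y' j := by
    rw [hg, map_add, map_sum, map_sum]
    simp only [map_smul, hNx, hNy, smul_zero, Finset.sum_const_zero, add_zero, Finset.smul_sum, smul_smul]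
    rw [Finset.sum_comm]
    refine Finset.sum_congr rfl fun j _ => ?_
    rw [← Finset.sum_smul, Matrix.mulVec, dotProduct]
    exact congrArg (· • y' j) (Finset.sum_congr rfl fun i _ => mul_comm _ _)
  have h2 : ((g : ((ι → K) × (ι → K)) ≃ₗ[K] ((ι → K) × (ι → K))).symm (0, (T⁻¹ * N) *ᵥ p.1)) =
      ∑ j, (N *ᵥ p.1) j • y' j := by
    rw [symm_apply_inr_of_darboux g hg, Matrix.mulVec_mulVec, ← Matrix.mul_assoc, Matrix.mul_nonsing_inv _ hTd,
      Matrix.one_mul]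
  rw [h1, ← h2, LinearEquiv.apply_symm_apply]

include hg in
/-- **conjugating `u = 1 + b𝔫 ∈ Sp` by the mover gives the Siegel unipotent `n(b T⁻¹N)`** (as linear automorphisms):
`g u g⁻¹ = unipotentσ (b • T⁻¹N)`. [cite: MoeglinVignerasWaldspurger1987, Chap. 2 II.6] -/
theorem coe_conj_eq_unipotentσ_of_lower (hTd : IsUnit T.det) (𝔫 : ((ι → K) × (ι → K)) →ₗ[K] ((ι → K) × (ι → K)))
    (N : Matrix ι ι K) (hNx : ∀ i, 𝔫 (x' i) = ∑ j, N j i • y' j) (hNy : ∀ j, 𝔫 (y' j) = 0)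
    (u : symplecticGroup (polar (Matrix.toLinearMap₂' K T))) (b : K)
    (hu : ∀ p, (u : ((ι → K) × (ι → K)) ≃ₗ[K] ((ι → K) × (ι → K))) p = p + b • 𝔫 p) :
    ((g * u * g⁻¹ : symplecticGroup (polar (Matrix.toLinearMap₂' K T))) :
        ((ι → K) × (ι → K)) ≃ₗ[K] ((ι → K) × (ι → K))) = unipotentσ (b • Matrix.toLin' (T⁻¹ * N)) := by
  apply LinearEquiv.ext
  intro p
  rw [Subgroup.coe_mul, Subgroup.coe_mul, Subgroup.coe_inv, LinearEquiv.mul_apply, LinearEquiv.mul_apply,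
    LinearEquiv.coe_inv, hu, map_add, map_smul, LinearEquiv.apply_symm_apply,
    apply_comp_symm_eq_of_lower g hg hTd 𝔫 N hNx hNy, unipotentσ_apply, LinearMap.smul_apply, Matrix.toLin'_apply]
  ext <;> simp

/-- the second-degree datum of `n(T⁻¹N)`: `β_T(x, (T⁻¹N) x') = x ⬝ N x'`. [cite: Weil1964, n° 6, p. 151] -/
theorem toLinearMap₂'_toLin'_inv_mul (hTd : IsUnit T.det) (N : Matrix ι ι K) (x z : ι → K) :
    Matrix.toLinearMap₂' K T x (Matrix.toLin' (T⁻¹ * N) z) = x ⬝ᵥ (N *ᵥ z) := by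
  rw [Matrix.toLinearMap₂'_apply', Matrix.toLin'_apply, Matrix.mulVec_mulVec, ← Matrix.mul_assoc,
    Matrix.mul_nonsing_inv _ hTd, Matrix.one_mul]

/-- … with a scalar: `β_T(x, (b • T⁻¹N) x') = b (x ⬝ N x')`. [cite: Weil1964, n° 6, p. 151] -/
theorem toLinearMap₂'_smul_toLin'_inv_mul (hTd : IsUnit T.det) (N : Matrix ι ι K) (b : K) (x z : ι → K) :
    Matrix.toLinearMap₂' K T x ((b • Matrix.toLin' (T⁻¹ * N)) z) = b * (x ⬝ᵥ (N *ᵥ z)) := by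
  rw [LinearMap.smul_apply, map_smul, smul_eq_mul, toLinearMap₂'_toLin'_inv_mul hTd]

/-- `n(b • T⁻¹N)` is a SIEGEL unipotent (`β_T`-symmetric) when `N` is symmetric. [cite: Weil1964, n° 6, p. 151] -/
theorem toLinearMap₂'_smul_toLin'_inv_mul_symm (hTd : IsUnit T.det) {N : Matrix ι ι K} (hN : N.IsSymm) (b : K)
    (x z : ι → K) :
    Matrix.toLinearMap₂' K T x ((b • Matrix.toLin' (T⁻¹ * N)) z) =
      Matrix.toLinearMap₂' K T z ((b • Matrix.toLin' (T⁻¹ * N)) x) := by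
  rw [toLinearMap₂'_smul_toLin'_inv_mul hTd, toLinearMap₂'_smul_toLin'_inv_mul hTd]
  have : x ⬝ᵥ (N *ᵥ z) = z ⬝ᵥ (N *ᵥ x) := by
    conv_lhs => rw [Matrix.dotProduct_mulVec, ← Matrix.mulVec_transpose, hN.eq, dotProduct_comm]
  rw [this]

include hg in
/-- **… as elements of `Sp`**: `g u g⁻¹ = unipotentSp β_T (b • T⁻¹N)`. [cite: MoeglinVignerasWaldspurger1987, Chap. 2 II.6] -/
theorem conj_eq_unipotentSp_of_lower [Invertible (2 : K)] (hTd : IsUnit T.det)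
    (𝔫 : ((ι → K) × (ι → K)) →ₗ[K] ((ι → K) × (ι → K))) (N : Matrix ι ι K)
    (hNx : ∀ i, 𝔫 (x' i) = ∑ j, N j i • y' j) (hNy : ∀ j, 𝔫 (y' j) = 0)
    (u : symplecticGroup (polar (Matrix.toLinearMap₂' K T))) (b : K)
    (hu : ∀ p, (u : ((ι → K) × (ι → K)) ≃ₗ[K] ((ι → K) × (ι → K))) p = p + b • 𝔫 p)
    (hb : ∀ x z : ι → K, Matrix.toLinearMap₂' K T x ((b • Matrix.toLin' (T⁻¹ * N)) z) =
      Matrix.toLinearMap₂' K T z ((b • Matrix.toLin' (T⁻¹ * N)) x)) :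
    g * u * g⁻¹ = unipotentSp (Matrix.toLinearMap₂' K T) (b • Matrix.toLin' (T⁻¹ * N)) hb :=
  Subtype.ext (by rw [coe_conj_eq_unipotentσ_of_lower g hg hTd 𝔫 N hNx hNy u b hu, coe_unipotentSp])

/-- the second-degree function of `n(b • T⁻¹N)` is `x ↦ ½ b (x ⬝ N x)`. [cite: Weil1964, n° 6, p. 151] -/
theorem secondDegree_smul_toLin'_inv_mul [Invertible (2 : K)] (hTd : IsUnit T.det) (N : Matrix ι ι K) (b : K)
    (x : ι → K) :
    ⅟(2 : K) * Matrix.toLinearMap₂' K T x ((b • Matrix.toLin' (T⁻¹ * N)) x) = ⅟(2 : K) * b * (x ⬝ᵥ (N *ᵥ x)) := by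
  rw [toLinearMap₂'_smul_toLin'_inv_mul hTd, mul_assoc]

/-! ## §3 A nilpotent in upper position -/

include hg in
/-- **an upper nilpotent is moved to `(x, y) ↦ ((N'T) y, 0)`**: if `𝔫' y'ⱼ = Σᵢ N'ᵢⱼ x'ᵢ` and `𝔫' x'ᵢ = 0` then
`g 𝔫' g⁻¹ (x, y) = ((N' T) y, 0)`. [cite: MoeglinVignerasWaldspurger1987, Chap. 2 II.6] -/
theorem apply_comp_symm_eq_of_upper (𝔫' : ((ι → K) × (ι → K)) →ₗ[K] ((ι → K) × (ι → K))) (N' : Matrix ι ι K)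
    (hNy : ∀ j, 𝔫' (y' j) = ∑ i, N' i j • x' i) (hNx : ∀ i, 𝔫' (x' i) = 0) (p : (ι → K) × (ι → K)) :
    (g : ((ι → K) × (ι → K)) ≃ₗ[K] ((ι → K) × (ι → K)))
        (𝔫' ((g : ((ι → K) × (ι → K)) ≃ₗ[K] ((ι → K) × (ι → K))).symm p)) = ((N' * T) *ᵥ p.2, 0) := by
  have h1 : 𝔫' ((g : ((ι → K) × (ι → K)) ≃ₗ[K] ((ι → K) × (ι → K))).symm p) = ∑ i, ((N' * T) *ᵥ p.2) i • x' i := by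
    rw [hg, map_add, map_sum, map_sum]
    simp only [map_smul, hNx, hNy, smul_zero, Finset.sum_const_zero, zero_add, Finset.smul_sum, smul_smul]
    rw [Finset.sum_comm]
    refine Finset.sum_congr rfl fun i _ => ?_
    rw [← Finset.sum_smul, ← Matrix.mulVec_mulVec, Matrix.mulVec, dotProduct]
    exact congrArg (· • x' i) (Finset.sum_congr rfl fun j _ => mul_comm _ _)
  rw [h1, ← symm_apply_inl_of_darboux g hg, LinearEquiv.apply_symm_apply]

include hg in
/-- **conjugating `u' = 1 + b𝔫' ∈ Sp` by the mover gives the opposite Siegel unipotent** `(x, y) ↦ (x + b (N'T) y, y)`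
(the conjugate of a Siegel unipotent by the Weyl element of the block carrying `N'`).
[cite: MoeglinVignerasWaldspurger1987, Chap. 2 II.6] -/
theorem coe_conj_apply_of_upper (𝔫' : ((ι → K) × (ι → K)) →ₗ[K] ((ι → K) × (ι → K))) (N' : Matrix ι ι K)
    (hNy : ∀ j, 𝔫' (y' j) = ∑ i, N' i j • x' i) (hNx : ∀ i, 𝔫' (x' i) = 0)
    (u : symplecticGroup (polar (Matrix.toLinearMap₂' K T))) (b : K)
    (hu : ∀ p, (u : ((ι → K) × (ι → K)) ≃ₗ[K] ((ι → K) × (ι → K))) p = p + b • 𝔫' p) (p : (ι → K) × (ι → K)) :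
    ((g * u * g⁻¹ : symplecticGroup (polar (Matrix.toLinearMap₂' K T))) :
        ((ι → K) × (ι → K)) ≃ₗ[K] ((ι → K) × (ι → K))) p = (p.1 + b • ((N' * T) *ᵥ p.2), p.2) := by
  rw [Subgroup.coe_mul, Subgroup.coe_mul, Subgroup.coe_inv, LinearEquiv.mul_apply, LinearEquiv.mul_apply,
    LinearEquiv.coe_inv, hu, map_add, map_smul, LinearEquiv.apply_symm_apply,
    apply_comp_symm_eq_of_upper g hg 𝔫' N' hNy hNx]
  ext <;> simp

end Mover

end Literature.RepresentationTheory.HeisenbergGroup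

end
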